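import Literature.MathematicalPhysics.QuantumLattice.HubbardOpenBoxWeightedClusterOracle
import HarnessLib

/-!
# The general-pair weighted one-band cluster on `ab` ranked orbitals (Emery-type windows, ring and ladder clusters)

Topic `MathematicalPhysics/QuantumLattice`, family `hubbard`. The weighted open cluster of Valentí–Stolze–Hirschfeld /
Anderson type with an ARBITRARY hopping graph: on the `ab` spinful orbitals of `Fin a ×ₗ Fin b` (used only as a
ranking device — any window of any lattice with `ab` one-orbital sites is relabelled onto it),

  `h^G = −Σ_{x ≠ y} Σ_σ τ(x,y) c†_{xσ} c_{yσ} + Σ_x υ(x) n_{x↑} n_{x↓} + Σ_x ν(x) (n_{x↑} + n_{x↓})`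

(`hubbardOpenBoxGP a b τ υ ν`; symmetric `τ`, zero entries = absent bonds). This is the shape of every one-orbital-per-
site cluster Hamiltonian: the `t–t'` weighted box of `HubbardNNNHoppingWeightedOpenBox` (τ supported on box bonds), rings,
ladders, and the Cu–O windows of the three-band (Emery) model in its one-orbital-per-site presentation (Cu `d` and O `p`
orbitals as sites with different `υ`, `ν`; `EmeryThreeBandCuO4WindowFloor`, hubbard-downfold-mod-4 / hubbard-box-p1).

* §1 the operator, Hermiticity (`τ` symmetric), sector preservation, spin-exchange invariance, homogeneity;
* §2 the occupation-code DICTIONARY (Lin–Gubernatis 1993 §II): `neAdjCode`, `hzIntGP a b W V M =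
  −openBoxHopW W neAdjCode (ab) + doccCodeW V (ab) + densCodeW M (ab)`, `hubbardOpenBoxGP_apply_eq_hzIntGP{_div}`,
  `hzIntGP_code_symm` — the input of the generic kernel ED floor device (`HubbardOpenBoxGeneralPairClusterOracle`).

Everything is proved; the three definitions have bodies; no named facts, no instances.

## References

* R. Valentí, J. Stolze, P. J. Hirschfeld, Phys. Rev. B 43 (1991) 13743, §II (weighted cluster covers). [cite: ValentiStolzeHirschfeld1991, §II]
* V. J. Emery, Phys. Rev. Lett. 58 (1987) 2794, eq. (1) (the three-band Cu–O model). [cite: Emery1987, eq. (1)]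
* H. Q. Lin, J. E. Gubernatis, Comput. Phys. 7 (1993) 400, §II. [cite: LinGubernatis1993, §II]
* E. H. Lieb, PRL 62 (1989) 1201, eq. (1), proof of Thm 1. [cite: LiebPRL1989, proof of Theorem 1]
-/

noncomputable section

namespace Literature.MathematicalPhysics.QuantumLattice

open Matrix Finset HubbardWave0

namespace ClusterLowerBound

variable {a b : ℕ}

/-! ### §1 The operator -/

/-- **The general-pair weighted cluster Hamiltonian** on the `ab` ranked spinful orbitals:
`h^G = −Σ_{x ≠ y, σ} τ(x,y) c†_{xσ} c_{yσ} + Σ_x υ(x) n_{x↑}n_{x↓} + Σ_x ν(x)(n_{x↑} + n_{x↓})`.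
[cite: ValentiStolzeHirschfeld1991, §II] [cite: Emery1987, eq. (1)] -/
def hubbardOpenBoxGP (a b : ℕ) (τ : Fin a ×ₗ Fin b → Fin a ×ₗ Fin b → ℝ) (υ ν : Fin a ×ₗ Fin b → ℝ) :
    Matrix (Finset (Orb (Fin a ×ₗ Fin b))) (Finset (Orb (Fin a ×ₗ Fin b))) ℂ :=
  -(∑ x : Fin a ×ₗ Fin b, ∑ y : Fin a ×ₗ Fin b, ∑ σ : Fin 2,
      if x ≠ y then ((τ x y : ℝ) : ℂ) • (creation (orb x σ) * annihilation (orb y σ)) else 0) +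
    ∑ x : Fin a ×ₗ Fin b, ((υ x : ℝ) : ℂ) • (numberOp x 0 * numberOp x 1) +
    ∑ x : Fin a ×ₗ Fin b, ((ν x : ℝ) : ℂ) • (numberOp x 0 + numberOp x 1)

/-- **`h^G` is Hermitian** for symmetric real weights. [cite: LiebPRL1989, eq. (1)] -/
theorem hubbardOpenBoxGP_isHermitian (τ : Fin a ×ₗ Fin b → Fin a ×ₗ Fin b → ℝ) (hτ : ∀ x y, τ x y = τ y x)
    (υ ν : Fin a ×ₗ Fin b → ℝ) : (hubbardOpenBoxGP a b τ υ ν).IsHermitian := by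
  have hT : (∑ x : Fin a ×ₗ Fin b, ∑ y : Fin a ×ₗ Fin b, ∑ σ : Fin 2,
      (if x ≠ y then ((τ x y : ℝ) : ℂ) • (creation (orb x σ) * annihilation (orb y σ))
        else (0 : Matrix (Finset (Orb (Fin a ×ₗ Fin b))) (Finset (Orb (Fin a ×ₗ Fin b))) ℂ)))ᴴ =
      ∑ x : Fin a ×ₗ Fin b, ∑ y : Fin a ×ₗ Fin b, ∑ σ : Fin 2,
        (if x ≠ y then ((τ x y : ℝ) : ℂ) • (creation (orb x σ) * annihilation (orb y σ)) else 0) := by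
    simp only [conjTranspose_sum]
    rw [Finset.sum_comm]
    refine Finset.sum_congr rfl fun x _ => Finset.sum_congr rfl fun y _ => Finset.sum_congr rfl fun σ _ => ?_
    by_cases h : y ≠ x
    · rw [if_pos h, if_pos (Ne.symm h), conjTranspose_smul, conjTranspose_mul, creation, creation,
        conjTranspose_conjTranspose, hτ x y, Complex.star_def, Complex.conj_ofReal]
    · rw [if_neg h, if_neg (fun h' => h (Ne.symm h')), conjTranspose_zero]
  have hV : (∑ x : Fin a ×ₗ Fin b, ((υ x : ℝ) : ℂ) •
      (numberOp x 0 * numberOp x 1 : Matrix (Finset (Orb (Fin a ×ₗ Fin b))) (Finset (Orb (Fin a ×ₗ Fin b))) ℂ))ᴴ =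
      ∑ x : Fin a ×ₗ Fin b, ((υ x : ℝ) : ℂ) • (numberOp x 0 * numberOp x 1) := by
    rw [conjTranspose_sum]
    refine Finset.sum_congr rfl fun x _ => ?_
    rw [conjTranspose_smul, conjTranspose_mul, Complex.star_def, Complex.conj_ofReal]
    change _ • ((numberAt (orb x 1))ᴴ * (numberAt (orb x 0))ᴴ) = _ • (numberAt (orb x 0) * numberAt (orb x 1))
    rw [(numberAt_isHermitian _).eq, (numberAt_isHermitian _).eq, (numberAt_commute _ _).eq]
  have hN : (∑ x : Fin a ×ₗ Fin b, ((ν x : ℝ) : ℂ) •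
      (numberOp x 0 + numberOp x 1 : Matrix (Finset (Orb (Fin a ×ₗ Fin b))) (Finset (Orb (Fin a ×ₗ Fin b))) ℂ))ᴴ =
      ∑ x : Fin a ×ₗ Fin b, ((ν x : ℝ) : ℂ) • (numberOp x 0 + numberOp x 1) := by
    rw [conjTranspose_sum]
    refine Finset.sum_congr rfl fun x _ => ?_
    rw [conjTranspose_smul, conjTranspose_add, Complex.star_def, Complex.conj_ofReal]
    change _ • ((numberAt (orb x 0))ᴴ + (numberAt (orb x 1))ᴴ) = _ • (numberAt (orb x 0) + numberAt (orb x 1))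
    rw [(numberAt_isHermitian _).eq, (numberAt_isHermitian _).eq]
  unfold hubbardOpenBoxGP
  rw [IsHermitian, conjTranspose_add, conjTranspose_add, conjTranspose_neg, hT, hV, hN]

/-- Negatives of sector-preserving matrices preserve sectors. [folklore] -/
private theorem preservesSectors_neg'' {Λ : Type*} [LinearOrder Λ] [Fintype Λ]
    {M : Matrix (Finset (Orb Λ)) (Finset (Orb Λ)) ℂ} (hM : PreservesSectors M) : PreservesSectors (-M) := by
  have h := hM.smul (-1 : ℂ)
  rwa [neg_one_smul] at h

/-- **`h^G` conserves `N↑` and `N↓`.** [cite: LiebPRL1989, proof of Theorem 1] -/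
theorem preservesSectors_hubbardOpenBoxGP (τ : Fin a ×ₗ Fin b → Fin a ×ₗ Fin b → ℝ) (υ ν : Fin a ×ₗ Fin b → ℝ) :
    PreservesSectors (hubbardOpenBoxGP a b τ υ ν) := by
  unfold hubbardOpenBoxGP
  refine ((preservesSectors_neg'' (PreservesSectors.sum fun x _ => PreservesSectors.sum fun y _ =>
    PreservesSectors.sum fun σ _ => ((LiebThm1.preservesSectors_hopping x y σ).smul _).ite _)).add
      (PreservesSectors.sum fun x _ => ((LiebThm1.preservesSectors_numberOp x 0).mul
        (LiebThm1.preservesSectors_numberOp x 1)).smul _)).add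
      (PreservesSectors.sum fun x _ => ((LiebThm1.preservesSectors_numberOp x 0).add
        (LiebThm1.preservesSectors_numberOp x 1)).smul _)

/-- **`h^G` is spin-exchange invariant.** [cite: LiebPRL1989, proof of Theorem 1] -/
theorem relabel_spinSwap_hubbardOpenBoxGP (τ : Fin a ×ₗ Fin b → Fin a ×ₗ Fin b → ℝ) (υ ν : Fin a ×ₗ Fin b → ℝ) :
    relabel (Orb.spinSwap : Orb (Fin a ×ₗ Fin b) ≃ Orb (Fin a ×ₗ Fin b)) (hubbardOpenBoxGP a b τ υ ν) =
      hubbardOpenBoxGP a b τ υ ν := by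
  unfold hubbardOpenBoxGP
  rw [map_add, map_add, map_neg, map_sum, map_sum, map_sum]
  congr 1
  congr 1
  · congr 1
    refine Finset.sum_congr rfl fun x _ => ?_
    rw [map_sum]
    refine Finset.sum_congr rfl fun y _ => ?_
    rw [map_sum]
    refine Fintype.sum_equiv (Equiv.swap (0 : Fin 2) 1) _ _ fun σ => ?_
    split_ifs
    · rw [map_smul, map_mul, relabel_creation, relabel_annihilation, Orb.spinSwap_orb, Orb.spinSwap_orb]
    · rw [map_zero]
  · refine Finset.sum_congr rfl fun x _ => ?_
    rw [map_smul, relabel_spinSwap_numberOp_mul_numberOp]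
  · refine Finset.sum_congr rfl fun x _ => ?_
    rw [map_smul, map_add, relabel_spinSwap_numberOp, relabel_spinSwap_numberOp, Equiv.swap_apply_left,
      Equiv.swap_apply_right, add_comm]

/-- **Homogeneity** in the weight tables: `h^G(cτ, cυ, cν) = c · h^G(τ, υ, ν)`. [cite: ValentiStolzeHirschfeld1991, §II] -/
theorem hubbardOpenBoxGP_scale (c : ℝ) (τ : Fin a ×ₗ Fin b → Fin a ×ₗ Fin b → ℝ) (υ ν : Fin a ×ₗ Fin b → ℝ) :
    hubbardOpenBoxGP a b (fun x y => c * τ x y) (fun x => c * υ x) (fun x => c * ν x) =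
      (c : ℂ) • hubbardOpenBoxGP a b τ υ ν := by
  unfold hubbardOpenBoxGP
  rw [smul_add, smul_add, smul_neg, Finset.smul_sum, Finset.smul_sum, Finset.smul_sum]
  congr 1
  congr 1
  · congr 1
    refine Finset.sum_congr rfl fun x _ => ?_
    rw [Finset.smul_sum]
    refine Finset.sum_congr rfl fun y _ => ?_
    rw [Finset.smul_sum]
    refine Finset.sum_congr rfl fun σ _ => ?_
    split_ifs
    · rw [smul_smul, Complex.ofReal_mul]
    · rw [smul_zero]
  · refine Finset.sum_congr rfl fun x _ => ?_
    rw [smul_smul, Complex.ofReal_mul]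
  · refine Finset.sum_congr rfl fun x _ => ?_
    rw [smul_smul, Complex.ofReal_mul]

/-- **Entries** of `h^G` in the occupation basis. [cite: LinGubernatis1993, §II] -/
theorem hubbardOpenBoxGP_apply (τ : Fin a ×ₗ Fin b → Fin a ×ₗ Fin b → ℝ) (υ ν : Fin a ×ₗ Fin b → ℝ)
    (s s' : Finset (Orb (Fin a ×ₗ Fin b))) :
    hubbardOpenBoxGP a b τ υ ν s s' =
      -(∑ x : Fin a ×ₗ Fin b, ∑ y : Fin a ×ₗ Fin b, ∑ σ : Fin 2,
          if x ≠ y then ((τ x y : ℝ) : ℂ) * (creation (orb x σ) * annihilation (orb y σ)) s s' else 0) +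
        ∑ x : Fin a ×ₗ Fin b, ((υ x : ℝ) : ℂ) * (numberOp x 0 * numberOp x 1) s s' +
        ∑ x : Fin a ×ₗ Fin b, ((ν x : ℝ) : ℂ) * ((numberOp x 0) s s' + (numberOp x 1) s s') := by
  rw [hubbardOpenBoxGP, Matrix.add_apply, Matrix.add_apply, Matrix.neg_apply]
  congr 1
  congr 1
  · congr 1
    rw [Matrix.sum_apply]
    refine Finset.sum_congr rfl fun x _ => ?_
    rw [Matrix.sum_apply]
    refine Finset.sum_congr rfl fun y _ => ?_
    rw [Matrix.sum_apply]
    refine Finset.sum_congr rfl fun σ _ => ?_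
    split_ifs
    · rw [Matrix.smul_apply, smul_eq_mul]
    · rfl
  · rw [Matrix.sum_apply]
    refine Finset.sum_congr rfl fun x _ => ?_
    rw [Matrix.smul_apply, smul_eq_mul]
  · rw [Matrix.sum_apply]
    refine Finset.sum_congr rfl fun x _ => ?_
    rw [Matrix.smul_apply, smul_eq_mul, Matrix.add_apply]

end ClusterLowerBound

/-! ### §2 The occupation-code dictionary -/

namespace OccupationCode

open ClusterLowerBound

variable {a b : ℕ}

/-- Coded "different sites" adjacency (all ordered pairs of distinct ranks carry a — possibly zero — weight).
[cite: LinGubernatis1993, §II] -/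
def neAdjCode (P Q : ℕ) : Bool := !(P == Q)

/-- The coded all-pairs adjacency is `x ≠ y` on the sites. [cite: LinGubernatis1993, §II] -/
theorem neAdjCode_siteRank (x y : Fin a ×ₗ Fin b) : neAdjCode (siteRank x) (siteRank y) = true ↔ x ≠ y := by
  rw [neAdjCode, Bool.not_eq_true', beq_eq_false_iff_ne, ne_eq, ne_eq]
  exact not_congr ⟨fun h => siteRank_injective h, fun h => h ▸ rfl⟩

/-- **The integer-coded entry function of the general-pair cluster**:
`hzIntGP = −openBoxHopW W neAdjCode (ab) + doccCodeW V (ab) + densCodeW M (ab)`. [cite: LinGubernatis1993, §II] -/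
def hzIntGP (a b : ℕ) (W : ℕ → ℕ → ℤ) (V M : ℕ → ℤ) (m m' : ℕ) : ℤ :=
  -openBoxHopW W neAdjCode (a * b) m m' + doccCodeW V (a * b) m m' + densCodeW M (a * b) m m'

/-- Casting a structural integer sum. [folklore] -/
private theorem cast_sumNat₃ (f : ℕ → ℤ) : ∀ n : ℕ, ((sumNat f n : ℤ) : ℂ) = sumNat (fun i => (f i : ℂ)) n
  | 0 => by simp [sumNat]
  | n + 1 => by rw [sumNat, sumNat, Int.cast_add, cast_sumNat₃ f n]

/-- The all-pairs weighted hopping part in code form. [cite: LinGubernatis1993, §II] -/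
theorem sum_hopGP_eq_openBoxHopW (W : ℕ → ℕ → ℤ) (s s' : Finset (Orb (Fin a ×ₗ Fin b))) :
    (∑ x : Fin a ×ₗ Fin b, ∑ y : Fin a ×ₗ Fin b, ∑ σ : Fin 2,
        if x ≠ y then (((W (siteRank x) (siteRank y) : ℤ) : ℝ) : ℂ) * (creation (orb x σ) * annihilation (orb y σ)) s s'
        else 0) =
      ((openBoxHopW W neAdjCode (a * b) (code s) (code s') : ℤ) : ℂ) := by
  simp only [openBoxHopW, cast_sumNat₃, Int.cast_ite, Int.cast_zero, Int.cast_mul]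
  rw [← sum_site_eq_sumNat]
  refine Finset.sum_congr rfl fun x _ => ?_
  rw [← sum_site_eq_sumNat]
  refine Finset.sum_congr rfl fun y _ => ?_
  by_cases hxy : x ≠ y
  · rw [if_pos ((neAdjCode_siteRank x y).2 hxy)]
    simp only [if_pos hxy]
    rw [Fin.sum_univ_two, sumNat, sumNat, sumNat, creation_mul_annihilation_apply_eq_hopCode,
      creation_mul_annihilation_apply_eq_hopCode, orbRank_orb, orbRank_orb, orbRank_orb, orbRank_orb]
    push_cast
    simp only [Fin.val_zero, Fin.val_one, add_zero, zero_add]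
    ring
  · have : neAdjCode (siteRank x) (siteRank y) = false := Bool.eq_false_iff.2 fun h => hxy ((neAdjCode_siteRank x y).1 h)
    rw [this]
    simp [hxy]

/-- **THE DICTIONARY (integer tables)**: `h^G s s' = hzIntGP a b W V M (code s) (code s')`. [cite: LinGubernatis1993, §II] -/
theorem hubbardOpenBoxGP_apply_eq_hzIntGP (W : ℕ → ℕ → ℤ) (V M : ℕ → ℤ) (s s' : Finset (Orb (Fin a ×ₗ Fin b))) :
    hubbardOpenBoxGP a b (fun x y => (W (siteRank x) (siteRank y) : ℝ)) (fun x => (V (siteRank x) : ℝ))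
        (fun x => (M (siteRank x) : ℝ)) s s' =
      ((hzIntGP a b W V M (code s) (code s') : ℝ) : ℂ) := by
  rw [hubbardOpenBoxGP_apply, sum_hopGP_eq_openBoxHopW, sum_doccW_eq_doccCodeW, sum_densW_eq_densCodeW, hzIntGP]
  push_cast
  ring

/-- **THE DICTIONARY (rational tables `W/q`, `V/q`, `M/q`)**: `h^G s s' = hzIntGP (code s) (code s') / q`.
[cite: LinGubernatis1993, §II] -/
theorem hubbardOpenBoxGP_apply_eq_hzIntGP_div (W : ℕ → ℕ → ℤ) (V M : ℕ → ℤ) (q : ℝ)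
    (s s' : Finset (Orb (Fin a ×ₗ Fin b))) :
    hubbardOpenBoxGP a b (fun x y => (W (siteRank x) (siteRank y) : ℝ) / q) (fun x => (V (siteRank x) : ℝ) / q)
        (fun x => (M (siteRank x) : ℝ) / q) s s' =
      (((hzIntGP a b W V M (code s) (code s') : ℝ) / q : ℝ) : ℂ) := by
  have h := hubbardOpenBoxGP_scale (a := a) (b := b) q⁻¹ (fun x y => (W (siteRank x) (siteRank y) : ℝ))
    (fun x => (V (siteRank x) : ℝ)) (fun x => (M (siteRank x) : ℝ))
  simp only [← div_eq_inv_mul] at h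
  rw [h, Matrix.smul_apply, hubbardOpenBoxGP_apply_eq_hzIntGP, smul_eq_mul, div_eq_inv_mul, Complex.ofReal_mul,
    Complex.ofReal_inv]

/-- **Symmetry of the coded matrix** for symmetric weights. [cite: LinGubernatis1993, §II] -/
theorem hzIntGP_code_symm (W : ℕ → ℕ → ℤ) (hW : ∀ P Q, W P Q = W Q P) (V M : ℕ → ℤ)
    (s s' : Finset (Orb (Fin a ×ₗ Fin b))) :
    hzIntGP a b W V M (code s) (code s') = hzIntGP a b W V M (code s') (code s) := by
  have hH := (hubbardOpenBoxGP_isHermitian (a := a) (b := b) (fun x y => (W (siteRank x) (siteRank y) : ℝ))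
    (fun x y => by simp only [hW]) (fun x => (V (siteRank x) : ℝ)) (fun x => (M (siteRank x) : ℝ))).apply s s'
  rw [hubbardOpenBoxGP_apply_eq_hzIntGP, hubbardOpenBoxGP_apply_eq_hzIntGP, RCLike.star_def,
    Complex.conj_ofReal] at hH
  exact_mod_cast hH.symm

end OccupationCode

end Literature.MathematicalPhysics.QuantumLattice
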